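import Summits.CriticalPhenomena.PercolationContinuityZ3.Theorems.FK.OSSSCouplingRecursion
import HarnessLib

/-!
# The OSSS inequality for monotonic measures (Duminil-Copin–Raoufi–Tassion 2019, Thm 1.1), covariance form

Claimed R42 (8)(c) in the cell INBOX at 2026-08-28T01:24:06Z by fkp-10a gen 352 (NEW CLAIM #1 of the gen) under provision (ι) (no coordinator fk-4 seated since gen 263 closed, cell INBOX l.8248; the lane lead absorbs the registry word; silence = consent; a seated coordinator's word would govern); lineage row FO-10a-g352 (self-suggested), package g352-osss, label OS-C.
Support file of the `fk-continuity` cell (lineage fkp-10a, `--supports stmt-CriticalPhenomena-4575`); builds on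
p205010 (kernel theorem, internal audit signed; external expert review pending).  No definitions, no named facts,
no sorries; standard axioms.  GENERIC finite-probability-space theory (any finite index type `ι`; no lattice, no `d`,
no `q`): the decision-tree input of the OSSS / sharpness programme for the random-cluster model
(Duminil-Copin–Raoufi–Tassion 2019, Thm 1.2), whose instantiation to the wired FK box measures on `ℤ^d` is the
business of the later files of package `g352-osss`.

THE THEOREM (`cov_le_sum_revealment_mul_cov`). `ι` finite, `μ : (ι → Bool) → ℝ` a probability weight with
`μ > 0` and the FKG lattice condition (a strictly positive MONOTONIC measure, Grimmett 2006 Thm (2.24)), `T` a reduced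
decision tree (`DecTree`, O'Donnell–Saks–Schramm–Servedio) whose output `F = T.eval` takes values in `[0, M]`, and
`g ≥ 0` increasing.  Then

  `E_μ[F g] − E_μ[F] E_μ[g] ≤ M · Σ_j δ_j(T) · Cov_μ(g, ω_j)`,   `δ_j(T) = μ(T queries j)`

(DRT's Theorem 1.1 is the case `F = g = f`, `M = 1`: `Var(f) ≤ Σ_e δ_e(f,T) Cov(f, ω_e)`; the two-function form is the
one consumed by sharpness arguments, their Lemma 3.2).

PROOF ROUTE (ours — the source instead encodes `μ` by i.i.d. uniforms, its Lemma 2.1, and runs a Lindeberg swap in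
`[0,1]^n`; here everything is a finite sum).  With the coupled functional `Sh` of `OSSSCouplingRecursion.lean`
(monotone two-history coupling along the query order), `sh_le_main` proves by induction on the tree
`Sh t D ξ ξ' ≤ E[F|ξ] E[g|ξ'] + M Σ_j δ_j(t|ξ) Cov(g, ω_j | ξ')`: at the root querying `e`,
(monotone step) − (independent step) `= (min(α,α') − αα')·{[S₁₁ − S₁₀] − [S₀₁ − S₀₀]}`
`≤ α'(1−α')·M·(E[g|ω_e=1] − E[g|ω_e=0]) = M·Cov(g, ω_e | ξ')` by `sh_mono_right`, while the independent step
averages the four continuations, whose inductive bounds recombine through the towers for `E[F|·]`, `δ_j(·)` and the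
one-edge total-covariance inequality `α' Cov(g,ω_j|ω_e=1) + (1−α') Cov(g,ω_j|ω_e=0) ≤ Cov(g,ω_j)`.  At `D = ∅` the
diagonal `sh_diag` (`Sh T ∅ = E[F g]`) turns this into the theorem; the auxiliary functionals are instantiated there by
their closed forms and `DecTree.rec`, so the file has no definitions.

## References
* H. Duminil-Copin, A. Raoufi, V. Tassion, *Sharp phase transition for the random-cluster and Potts models via decision
  trees*, Ann. of Math. 189 (2019) 75–99, Thm 1.1, §2, Rmk 2.2. [DuminilCopinRaoufiTassion2019]
* R. O'Donnell, M. Saks, O. Schramm, R. Servedio, *Every decision tree has an influential variable*, FOCS 2005, Thm 3.2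
  (two-function form). [OdonnellEtAl2005]
* G. Grimmett, *The Random-Cluster Model*, Springer 2006, §2.2 Thm (2.24). [Grimmett2006]
-/

namespace Summit.CriticalPhenomena.PercolationContinuityZ3.Theorems.FK

namespace MonotonicOSSS

open Finset Function Literature.Probability.ODonnellSaksSchrammServedio2005

variable {ι : Type*} [Fintype ι] [DecidableEq ι]

variable (μ g : (ι → Bool) → ℝ) (w : Finset ι → (ι → Bool) → (ι → Bool) → ℝ) (Z : Finset ι → (ι → Bool) → ℝ)
  (Pr : Finset ι → (ι → Bool) → ι → ℝ) (Eg : Finset ι → (ι → Bool) → ℝ)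
  (Sh : DecTree ι → Finset ι → (ι → Bool) → (ι → Bool) → ℝ)

/-! ### The main inequality -/

/-- THE MAIN RECURSIVE INEQUALITY: for a reduced tree `t` whose variables avoid `D`, `0 ≤ F = t.eval ≤ M`, `g ≥ 0`
increasing, and any histories `ξ` (for `X`) and `ξ'` (for `Y`) on `D`,
`Sh t D ξ ξ' ≤ E[F|ξ] E[g|ξ'] + M Σ_j δ_j(t|ξ) Cov(g, ω_j | ξ')`.
[cite: DuminilCopinRaoufiTassion2019, §2 proof of Thm 1.1 (the telescoping bound over the queries, eq. (2.3))] -/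
theorem sh_le_main (hw : ∀ D ξ x, w D ξ x = if (∀ i ∈ D, x i = ξ i) then μ x else 0)
    (hZ : ∀ D ξ, Z D ξ = ∑ x, w D ξ x) (hPr : ∀ D ξ e, Pr D ξ e = Z (insert e D) (update ξ e true) / Z D ξ)
    (hEg : ∀ D ξ, Eg D ξ = (∑ x, w D ξ x * g x) / Z D ξ) (hμ0 : ∀ x, 0 < μ x)
    (hμ : ∀ a b, μ a * μ b ≤ μ (a ⊓ b) * μ (a ⊔ b)) (hg0 : ∀ x, 0 ≤ g x) (hg : Monotone g)
    (hSh0 : ∀ v D ξ ξ', Sh (DecTree.leaf v) D ξ ξ' = v * Eg D ξ')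
    (hSh1 : ∀ e t₀ t₁ D ξ ξ', Sh (DecTree.node e t₀ t₁) D ξ ξ' =
        min (Pr D ξ e) (Pr D ξ' e) * Sh t₁ (insert e D) (update ξ e true) (update ξ' e true)
      + (1 - max (Pr D ξ e) (Pr D ξ' e)) * Sh t₀ (insert e D) (update ξ e false) (update ξ' e false)
      + max 0 (Pr D ξ e - Pr D ξ' e) * Sh t₁ (insert e D) (update ξ e true) (update ξ' e false)
      + max 0 (Pr D ξ' e - Pr D ξ e) * Sh t₀ (insert e D) (update ξ e false) (update ξ' e true))
    (EF : DecTree ι → Finset ι → (ι → Bool) → ℝ) (hEF : ∀ t D ξ, EF t D ξ = (∑ x, w D ξ x * t.eval x) / Z D ξ)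
    (Dl : DecTree ι → Finset ι → (ι → Bool) → ι → ℝ)
    (hDl : ∀ t D ξ j, Dl t D ξ j = (∑ x, w D ξ x * (if j ∈ t.queried x then 1 else 0)) / Z D ξ)
    (Cv : Finset ι → (ι → Bool) → ι → ℝ)
    (hCv : ∀ D ξ j, Cv D ξ j = (∑ x, w D ξ x * (g x * if x j = true then 1 else 0)) / Z D ξ
      - Eg D ξ * ((∑ x, w D ξ x * (if x j = true then 1 else 0)) / Z D ξ)) {M : ℝ} :
    ∀ t : DecTree ι, t.Reduced → (∀ x, 0 ≤ t.eval x ∧ t.eval x ≤ M) →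
      ∀ (D : Finset ι) (ξ ξ' : ι → Bool), (∀ i ∈ t.vars, i ∉ D) →
        Sh t D ξ ξ' ≤ EF t D ξ * Eg D ξ' + M * ∑ j, Dl t D ξ j * Cv D ξ' j := by
  intro t
  induction t with
  | leaf v =>
    intro _ _ D ξ ξ' _
    have hZ0 := (Z_pos μ w Z hw hZ hμ0 D ξ).ne'
    have hEF0 : EF (DecTree.leaf v) D ξ = v := by
      rw [hEF]; simp only [DecTree.eval]
      rw [← Finset.sum_mul, ← hZ, mul_comm, mul_div_assoc, div_self hZ0, mul_one]
    have hDl0 : ∀ j, Dl (DecTree.leaf v) D ξ j = 0 := fun j => by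
      rw [hDl]; simp [DecTree.queried]
    simp only [hSh0, hEF0, hDl0, zero_mul, Finset.sum_const_zero, mul_zero, add_zero, le_refl]
  | node e t₀ t₁ ih₀ ih₁ =>
    intro hred hF D ξ ξ' hvars
    simp only [DecTree.Reduced] at hred
    obtain ⟨he₀, he₁, hr₀, hr₁⟩ := hred
    have he : e ∉ D := hvars e (by simp [DecTree.vars])
    have hv₀ := vars_sub_notMem_insert (Or.inl rfl) he₀ hvars
    have hv₁ := vars_sub_notMem_insert (Or.inr rfl) he₁ hvars
    have hF₀ := eval_bounds_node_false he₀ hF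
    have hF₁ := eval_bounds_node_true he₁ hF
    have hM : 0 ≤ M := (hF (fun _ => false)).1.trans (hF (fun _ => false)).2
    -- inductive hypotheses for the four (X-bit, Y-bit) continuations
    have Itt := ih₁ hr₁ hF₁ (insert e D) (update ξ e true) (update ξ' e true) hv₁
    have Itf := ih₁ hr₁ hF₁ (insert e D) (update ξ e true) (update ξ' e false) hv₁
    have Ift := ih₀ hr₀ hF₀ (insert e D) (update ξ e false) (update ξ' e true) hv₀
    have Iff := ih₀ hr₀ hF₀ (insert e D) (update ξ e false) (update ξ' e false) hv₀
    -- monotonicity in the Y-history (coupling lemma)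
    have J1 := sh_mono_right μ g w Z Pr Eg Sh hw hZ hPr hEg hμ0 hμ hg0 hg hSh0 hSh1 t₁ hr₁ hF₁ (insert e D)
      (update ξ e true) (update ξ' e false) (update ξ' e true) hv₁ (update_false_le_update_true ξ' e)
    have J0 := sh_mono_right μ g w Z Pr Eg Sh hw hZ hPr hEg hμ0 hμ hg0 hg hSh0 hSh1 t₀ hr₀ hF₀ (insert e D)
      (update ξ e false) (update ξ' e false) (update ξ' e true) hv₀ (update_false_le_update_true ξ' e)
    -- towers
    have hEFt : EF (DecTree.node e t₀ t₁) D ξ = Pr D ξ e * EF t₁ (insert e D) (update ξ e true)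
        + (1 - Pr D ξ e) * EF t₀ (insert e D) (update ξ e false) := by
      rw [hEF, hEF, hEF]; exact ef_tower μ w Z Pr hw hZ hPr hμ0 e t₀ t₁ he ξ
    have hEgt := Eg_tower μ g w Z Pr Eg hw hZ hPr hEg hμ0 he ξ'
    have hDlt : ∀ j, Dl (DecTree.node e t₀ t₁) D ξ j = (if j = e then 1 else 0)
        + Pr D ξ e * Dl t₁ (insert e D) (update ξ e true) j
        + (1 - Pr D ξ e) * Dl t₀ (insert e D) (update ξ e false) j := fun j => by
      rw [hDl, hDl, hDl]; exact dl_tower μ w Z Pr hw hZ hPr hμ0 he₀ he₁ he ξ j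
    have hCve : Cv D ξ' e = Pr D ξ' e * (1 - Pr D ξ' e)
        * (Eg (insert e D) (update ξ' e true) - Eg (insert e D) (update ξ' e false)) := by
      rw [hCv]; exact cov_edge_self μ g w Z Pr Eg hw hZ hPr hEg hμ0 he ξ'
    have hCvt : ∀ j, Pr D ξ' e * Cv (insert e D) (update ξ' e true) j
        + (1 - Pr D ξ' e) * Cv (insert e D) (update ξ' e false) j ≤ Cv D ξ' j := fun j => by
      rw [hCv, hCv, hCv]; exact cov_tower_le μ g w Z Pr Eg hw hZ hPr hEg hμ0 hμ hg0 hg he ξ' j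
    have hDl0 : ∀ (t : DecTree ι) (D : Finset ι) (ξ : ι → Bool) (j : ι), 0 ≤ Dl t D ξ j := fun t D ξ j => by
      rw [hDl]
      exact div_nonneg (Finset.sum_nonneg fun x _ => mul_nonneg (w_nonneg μ w hw hμ0 _ _ _) (by positivity))
        (Z_pos μ w Z hw hZ hμ0 D ξ).le
    -- scalars
    have hα := Pr_pos μ w Z Pr hw hZ hPr hμ0 D ξ e
    have hα1 := Pr_lt_one μ w Z Pr hw hZ hPr hμ0 he ξ
    have hβ := Pr_pos μ w Z Pr hw hZ hPr hμ0 D ξ' e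
    have hβ1 := Pr_lt_one μ w Z Pr hw hZ hPr hμ0 he ξ'
    rw [hSh1, hEFt, hEgt]
    set α := Pr D ξ e
    set β := Pr D ξ' e
    -- the revealment sums
    set V := ∑ j, (α * Dl t₁ (insert e D) (update ξ e true) j + (1 - α) * Dl t₀ (insert e D) (update ξ e false) j)
      * Cv D ξ' j with hV
    have hsplit : ∑ j, Dl (DecTree.node e t₀ t₁) D ξ j * Cv D ξ' j = Cv D ξ' e + V := by
      simp_rw [hDlt, add_mul, Finset.sum_add_distrib, ite_mul, one_mul, zero_mul, Finset.sum_ite_eq' Finset.univ e,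
        if_pos (Finset.mem_univ e), hV]
      simp_rw [add_mul, Finset.sum_add_distrib, add_assoc]
    have hsum : ∑ j, (α * Dl t₁ (insert e D) (update ξ e true) j + (1 - α) * Dl t₀ (insert e D) (update ξ e false) j)
        * (β * Cv (insert e D) (update ξ' e true) j + (1 - β) * Cv (insert e D) (update ξ' e false) j) ≤ V :=
      Finset.sum_le_sum fun j _ => mul_le_mul_of_nonneg_left (hCvt j)
        (add_nonneg (mul_nonneg hα.le (hDl0 _ _ _ _)) (mul_nonneg (sub_nonneg.2 hα1.le) (hDl0 _ _ _ _)))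
    have hcomb : α * β * (∑ j, Dl t₁ (insert e D) (update ξ e true) j * Cv (insert e D) (update ξ' e true) j)
        + α * (1 - β) * (∑ j, Dl t₁ (insert e D) (update ξ e true) j * Cv (insert e D) (update ξ' e false) j)
        + (1 - α) * β * (∑ j, Dl t₀ (insert e D) (update ξ e false) j * Cv (insert e D) (update ξ' e true) j)
        + (1 - α) * (1 - β) * (∑ j, Dl t₀ (insert e D) (update ξ e false) j * Cv (insert e D) (update ξ' e false) j)
        = ∑ j, (α * Dl t₁ (insert e D) (update ξ e true) j + (1 - α) * Dl t₀ (insert e D) (update ξ e false) j)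
          * (β * Cv (insert e D) (update ξ' e true) j + (1 - β) * Cv (insert e D) (update ξ' e false) j) := by
      rw [Finset.mul_sum, Finset.mul_sum, Finset.mul_sum, Finset.mul_sum, ← Finset.sum_add_distrib,
        ← Finset.sum_add_distrib, ← Finset.sum_add_distrib]
      exact Finset.sum_congr rfl fun j _ => by ring
    -- coefficient × inductive fact
    have Q1 := mul_le_mul_of_nonneg_left Itt (mul_nonneg hα.le hβ.le)
    have Q2 := mul_le_mul_of_nonneg_left Itf (mul_nonneg hα.le (sub_nonneg.2 hβ1.le))
    have Q3 := mul_le_mul_of_nonneg_left Ift (mul_nonneg (sub_nonneg.2 hα1.le) hβ.le)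
    have Q4 := mul_le_mul_of_nonneg_left Iff (mul_nonneg (sub_nonneg.2 hα1.le) (sub_nonneg.2 hβ1.le))
    -- the monotone excess `min(α,β) − αβ` and its bound
    have hmm0 : 0 ≤ min α β - α * β := by
      rcases le_total α β with h | h
      · rw [min_eq_left h]; nlinarith
      · rw [min_eq_right h]; nlinarith
    have hmm1 : min α β - α * β ≤ β * (1 - β) := min_sub_mul_le hβ.le hβ1.le
    have hE : 0 ≤ Eg (insert e D) (update ξ' e true) - Eg (insert e D) (update ξ' e false) :=
      sub_nonneg.2 (Eg_mono μ g w Z Eg hw hZ hEg hμ0 hμ hg0 hg _ (update_false_le_update_true ξ' e))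
    have R1 := mul_nonneg hmm0 J0.1
    have R2 := mul_le_mul_of_nonneg_left J1.2 hmm0
    have R3 := mul_le_mul_of_nonneg_right hmm1 (mul_nonneg hM hE)
    have hU := mul_le_mul_of_nonneg_left (hcomb.trans_le hsum) hM
    rw [max_zero_sub_eq α β, max_zero_sub_eq β α, min_comm β α, one_sub_max_eq α β, hsplit, hCve]
    linarith [Q1, Q2, Q3, Q4, R1, R2, R3, hU]

/-! ### The theorem -/

/-- **THE OSSS INEQUALITY FOR MONOTONIC MEASURES, COVARIANCE FORM** (Duminil-Copin–Raoufi–Tassion 2019, Thm 1.1, in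
the two-function form of O'Donnell–Saks–Schramm–Servedio's Thm 3.2).  Let `μ` be a strictly positive probability weight
on `ι → Bool` (`ι` finite) satisfying the FKG lattice condition, `T` a reduced decision tree whose output `F = T.eval`
takes values in `[0, M]`, and `g ≥ 0` increasing.  Then
`E_μ[F g] − E_μ[F] E_μ[g] ≤ M · Σ_j μ(T queries j) · (E_μ[g ω_j] − E_μ[g] E_μ[ω_j])`.
For `F = g = f ∈ [0,1]` computed by `T` this is `Var_μ(f) ≤ Σ_e δ_e(f,T) Cov_μ(f, ω_e)`.
[cite: DuminilCopinRaoufiTassion2019, Thm 1.1] -/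
theorem cov_le_sum_revealment_mul_cov (μ : (ι → Bool) → ℝ) (hμ0 : ∀ x, 0 < μ x)
    (hμ : ∀ a b, μ a * μ b ≤ μ (a ⊓ b) * μ (a ⊔ b)) (hμ1 : ∑ x, μ x = 1) (T : DecTree ι) (hT : T.Reduced)
    {M : ℝ} (hF : ∀ x, 0 ≤ T.eval x ∧ T.eval x ≤ M) (g : (ι → Bool) → ℝ) (hg0 : ∀ x, 0 ≤ g x) (hg : Monotone g) :
    (∑ x, μ x * (T.eval x * g x)) - (∑ x, μ x * T.eval x) * (∑ x, μ x * g x)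
      ≤ M * ∑ j, (∑ x, μ x * (if j ∈ T.queried x then 1 else 0))
        * ((∑ x, μ x * (g x * if x j = true then 1 else 0)) - (∑ x, μ x * g x) * (∑ x, μ x * if x j = true then 1 else 0)) := by
  -- the explicit closed forms
  set w : Finset ι → (ι → Bool) → (ι → Bool) → ℝ := fun D ξ x => if (∀ i ∈ D, x i = ξ i) then μ x else 0 with hwd
  set Z : Finset ι → (ι → Bool) → ℝ := fun D ξ => ∑ x, w D ξ x with hZd
  set Pr : Finset ι → (ι → Bool) → ι → ℝ := fun D ξ e => Z (insert e D) (update ξ e true) / Z D ξ with hPrd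
  set Eg : Finset ι → (ι → Bool) → ℝ := fun D ξ => (∑ x, w D ξ x * g x) / Z D ξ with hEgd
  set EF : DecTree ι → Finset ι → (ι → Bool) → ℝ := fun t D ξ => (∑ x, w D ξ x * t.eval x) / Z D ξ with hEFd
  set Dl : DecTree ι → Finset ι → (ι → Bool) → ι → ℝ :=
    fun t D ξ j => (∑ x, w D ξ x * (if j ∈ t.queried x then 1 else 0)) / Z D ξ with hDld
  set Cv : Finset ι → (ι → Bool) → ι → ℝ := fun D ξ j => (∑ x, w D ξ x * (g x * if x j = true then 1 else 0)) / Z D ξ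
      - Eg D ξ * ((∑ x, w D ξ x * (if x j = true then 1 else 0)) / Z D ξ) with hCvd
  set Sh : DecTree ι → Finset ι → (ι → Bool) → (ι → Bool) → ℝ := fun t =>
    DecTree.rec (motive := fun _ => Finset ι → (ι → Bool) → (ι → Bool) → ℝ)
      (fun v D _ ξ' => v * Eg D ξ')
      (fun e _ _ S₀ S₁ D ξ ξ' =>
        min (Pr D ξ e) (Pr D ξ' e) * S₁ (insert e D) (update ξ e true) (update ξ' e true)
        + (1 - max (Pr D ξ e) (Pr D ξ' e)) * S₀ (insert e D) (update ξ e false) (update ξ' e false)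
        + max 0 (Pr D ξ e - Pr D ξ' e) * S₁ (insert e D) (update ξ e true) (update ξ' e false)
        + max 0 (Pr D ξ' e - Pr D ξ e) * S₀ (insert e D) (update ξ e false) (update ξ' e true)) t with hShd
  have hw : ∀ D ξ x, w D ξ x = if (∀ i ∈ D, x i = ξ i) then μ x else 0 := fun _ _ _ => rfl
  have hZ : ∀ D ξ, Z D ξ = ∑ x, w D ξ x := fun _ _ => rfl
  have hPr : ∀ D ξ e, Pr D ξ e = Z (insert e D) (update ξ e true) / Z D ξ := fun _ _ _ => rfl
  have hEg : ∀ D ξ, Eg D ξ = (∑ x, w D ξ x * g x) / Z D ξ := fun _ _ => rfl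
  have hSh0 : ∀ v D ξ ξ', Sh (DecTree.leaf v) D ξ ξ' = v * Eg D ξ' := fun _ _ _ _ => rfl
  have hSh1 : ∀ e t₀ t₁ D ξ ξ', Sh (DecTree.node e t₀ t₁) D ξ ξ' =
        min (Pr D ξ e) (Pr D ξ' e) * Sh t₁ (insert e D) (update ξ e true) (update ξ' e true)
      + (1 - max (Pr D ξ e) (Pr D ξ' e)) * Sh t₀ (insert e D) (update ξ e false) (update ξ' e false)
      + max 0 (Pr D ξ e - Pr D ξ' e) * Sh t₁ (insert e D) (update ξ e true) (update ξ' e false)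
      + max 0 (Pr D ξ' e - Pr D ξ e) * Sh t₀ (insert e D) (update ξ e false) (update ξ' e true) :=
    fun _ _ _ _ _ _ => rfl
  set ξ0 : ι → Bool := fun _ => false
  have main := sh_le_main μ g w Z Pr Eg Sh hw hZ hPr hEg hμ0 hμ hg0 hg hSh0 hSh1 EF (fun _ _ _ => rfl)
    Dl (fun _ _ _ _ => rfl) Cv (fun _ _ _ => rfl) T hT hF ∅ ξ0 ξ0 (fun i _ => Finset.notMem_empty i)
  rw [sh_diag μ g w Z Pr Eg Sh hw hZ hPr hEg hμ0 hSh0 hSh1 T hT ∅ ξ0 (fun i _ => Finset.notMem_empty i)] at main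
  have hw0 : ∀ x, w ∅ ξ0 x = μ x := fun x => w_empty μ w hw ξ0 x
  have hZ0 : Z ∅ ξ0 = 1 := by rw [hZ]; simp_rw [hw0]; exact hμ1
  simp only [hEFd, hDld, hCvd, hEgd, hw0, hZ0, div_one] at main
  linarith [main]

end MonotonicOSSS

end Summit.CriticalPhenomena.PercolationContinuityZ3.Theorems.FK
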